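import Literature.NumberTheory.Transcendental.NesterenkoElimination
import Mathlib.Algebra.MvPolynomial.Nilpotent
import HarnessLib

/-!
# Elementary structure of the associated form `F` of `Ī(r)` (LNM 1752 Ch. 3 §4) — what Corollary 4.10 needs

Topic `Literature/NumberTheory/Transcendental`. For the objects of `NesterenkoElimination.lean`
(Nesterenko–Philippon (eds.), LNM 1752 (2001), Ch. 3 §4, Definitions 4.3–4.6) we prove, directly
from the definitions, the two algebraic inputs of the proof of Corollary 4.10 ("the next two
Corollaries easily follow from definitions", p. 40):

* `map_mem_elimIdeal`: `Ī(r)` is stable under every algebra endomorphism of `ℚ[U]` that extends to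
  `ℚ[U, x̲]` fixing the `xⱼ` and mapping each `Lᵢ` into `(L₁, …, L_r)`; in particular under
  rescaling one block of variables `uᵢ ↦ c uᵢ` (`scaleU`) and under permuting the blocks (`swapU`).
  Hence a generator `F` of `Ī(r)` is an eigenvector of these maps (`exists_eq_C_mul_chowForm`),
  so `F` is multihomogeneous with all block degrees equal to `deg I = deg_{u₁} F`
  (`bdeg_eq_ideg_of_mem_support_chowForm`), and every monomial of `F` has total degree
  `r · deg I` (`degree_eq_of_mem_support_chowForm`) — the remark after Proposition 4.4 (p. 38).
* `kappa_smul_chowForm_eq_zero`: if `β̄ ∈ V(I)` then `ϰ_{cβ̄}(F) = 0` for every `c ∈ ℂ`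
  (substitute `x̲ = β̄`, `uᵢ = S⁽ⁱ⁾(cβ̄)` in `F xⱼ^M ∈ (I, L₁, …, L_r)`; the `Lᵢ` die by
  skew-symmetry).

Principality of `Ī(r)` (Proposition 4.4) is NOT used: when `Ī(r)` is not principal the tree's
`chowForm` is the junk value `0` and everything here is vacuous.

## References

* [NesterenkoPhilippon2001] Yu. V. Nesterenko, P. Philippon (eds.), *Introduction to Algebraic
  Independence Theory*, LNM 1752, Springer 2001, Ch. 3 §4, Def. 4.3–4.6, Prop. 4.4 and the remark
  after it (p. 38), Cor. 4.10 (p. 40).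
-/

noncomputable section

open MvPolynomial

namespace Literature.NumberTheory.Transcendental

namespace Nesterenko

variable {m : ℕ}

/-! ### Stability of `Ī(r)` under compatible endomorphisms -/

/-- If an algebra endomorphism `φ` of `ℚ[U]` extends to an endomorphism `Φ` of `ℚ[U, x̲]` that
fixes the `xⱼ` and maps every `Lᵢ` into the ideal `(L₁, …, L_r)`, then `φ(Ī(r)) ⊆ Ī(r)`.
[folklore] -/
theorem map_mem_elimIdeal (I : Ideal (Rx m)) (r : ℕ) (φ : RU r m →ₐ[ℚ] RU r m)
    (Φ : RUX r m →ₐ[ℚ] RUX r m)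
    (hU : ∀ v : Fin r × Fin (m + 1), Φ (X (Sum.inl v)) = rename Sum.inl (φ (X v)))
    (hx : ∀ j : Fin (m + 1), Φ (X (Sum.inr j)) = X (Sum.inr j))
    (hL : ∀ i : Fin r, Φ (linForm r m i) ∈ Ideal.span (Set.range (linForm r m)))
    {G : RU r m} (hG : G ∈ elimIdeal I r) : φ G ∈ elimIdeal I r := by
  have h1 : Φ.comp (rename Sum.inl) = (rename Sum.inl).comp φ := by
    apply MvPolynomial.algHom_ext
    intro v
    simp [hU]
  have h2 : Φ.comp (rename Sum.inr) = (rename Sum.inr : Rx m →ₐ[ℚ] RUX r m) := by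
    apply MvPolynomial.algHom_ext
    intro j
    simp [hx]
  have hA : Ideal.map (rename Sum.inr) I ≤ (extIdeal I r).comap Φ := by
    rw [Ideal.map_le_iff_le_comap]
    intro P hP
    rw [Ideal.mem_comap, Ideal.mem_comap,
      show Φ (rename Sum.inr P) = rename Sum.inr P from AlgHom.congr_fun h2 P]
    exact Ideal.mem_sup_left (Ideal.mem_map_of_mem _ hP)
  have hB : Ideal.span (Set.range (linForm r m)) ≤ (extIdeal I r).comap Φ := by
    rw [Ideal.span_le]
    rintro _ ⟨i, rfl⟩
    rw [SetLike.mem_coe, Ideal.mem_comap]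
    exact Ideal.mem_sup_right (hL i)
  have hext : extIdeal I r ≤ (extIdeal I r).comap Φ := sup_le hA hB
  obtain ⟨M, hM, hGM⟩ := hG
  refine ⟨M, hM, fun j => ?_⟩
  have h := hext (hGM j)
  rw [Ideal.mem_comap, map_mul, map_pow, hx j,
    show Φ (rename Sum.inl G) = rename Sum.inl (φ G) from AlgHom.congr_fun h1 G] at h
  exact h

/-- A generator `F` of `Ī(r)` is an eigenvector of every invertible endomorphism preserving `Ī(r)`:
`φ F = c F` with `c ∈ ℚˣ`. [folklore] -/
theorem exists_eq_C_mul_chowForm (I : Ideal (Rx m)) (r : ℕ) (φ ψ : RU r m →ₐ[ℚ] RU r m)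
    (hφ : ∀ G ∈ elimIdeal I r, φ G ∈ elimIdeal I r)
    (hψ : ∀ G ∈ elimIdeal I r, ψ G ∈ elimIdeal I r)
    (hinv : ∀ G, φ (ψ G) = G) (hpr : (elimIdeal I r).IsPrincipal) :
    ∃ c : ℚ, c ≠ 0 ∧ φ (chowForm I r) = C c * chowForm I r := by
  set F := chowForm I r
  have hspan : Ideal.span {F} = elimIdeal I r := span_chowForm I r hpr
  have hmap : Ideal.map φ (elimIdeal I r) = elimIdeal I r := by
    apply le_antisymm
    · rw [Ideal.map_le_iff_le_comap]
      intro G hG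
      exact hφ G hG
    · intro G hG
      rw [← hinv G]
      exact Ideal.mem_map_of_mem φ (hψ G hG)
  have hspan' : Ideal.span {φ F} = Ideal.span {F} := by
    rw [hspan, ← hmap, ← hspan, Ideal.map_span, Set.image_singleton]
  obtain ⟨u, hu⟩ := Ideal.span_singleton_eq_span_singleton.mp hspan'
  obtain ⟨c, hc, hcu⟩ := MvPolynomial.isUnit_iff_eq_C_of_isReduced.mp u.isUnit
  have hc0 : c ≠ 0 := hc.ne_zero
  refine ⟨c⁻¹, inv_ne_zero hc0, ?_⟩
  have hF : φ F * C c = F := by rw [← hcu]; exact hu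
  calc φ F = φ F * C c * C c⁻¹ := by
        rw [mul_assoc, ← C_mul, mul_inv_cancel₀ hc0, C_1, mul_one]
    _ = C c⁻¹ * F := by rw [hF, mul_comm]

/-! ### Rescaling one block of variables -/

/-- The endomorphism `u_{ij} ↦ c u_{ij}` (for the block `i` only) of `ℚ[U]`. [folklore] -/
def scaleU (r m : ℕ) (i : Fin r) (c : ℚ) : RU r m →ₐ[ℚ] RU r m :=
  aeval fun v : Fin r × Fin (m + 1) => if v.1 = i then C c * X v else X v

/-- Its extension to `ℚ[U, x̲]` fixing the `xⱼ`. [folklore] -/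
def scaleUX (r m : ℕ) (i : Fin r) (c : ℚ) : RUX r m →ₐ[ℚ] RUX r m :=
  aeval (Sum.elim (fun v : Fin r × Fin (m + 1) =>
    if v.1 = i then C c * X (Sum.inl v) else X (Sum.inl v)) fun j => X (Sum.inr j))

/-- `Ī(r)` is stable under rescaling a block of variables. [folklore] -/
theorem scaleU_mem_elimIdeal (I : Ideal (Rx m)) (r : ℕ) (i : Fin r) (c : ℚ) {G : RU r m}
    (hG : G ∈ elimIdeal I r) : scaleU r m i c G ∈ elimIdeal I r := by
  refine map_mem_elimIdeal I r (scaleU r m i c) (scaleUX r m i c) (fun v => ?_) (fun j => ?_)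
    (fun i' => ?_) hG
  · simp only [scaleU, scaleUX, aeval_X, Sum.elim_inl]
    split_ifs <;> simp
  · simp [scaleUX]
  · by_cases h : i' = i
    · subst h
      have e : scaleUX r m i' c (linForm r m i') = C c * linForm r m i' := by
        simp only [linForm, map_sum, map_mul, scaleUX, aeval_X, Sum.elim_inl, Sum.elim_inr,
          Finset.mul_sum]
        refine Finset.sum_congr rfl fun j _ => ?_
        rw [if_pos trivial]
        ring
      rw [e]
      exact Ideal.mul_mem_left _ _ (Ideal.subset_span ⟨i', rfl⟩)
    · have e : scaleUX r m i c (linForm r m i') = linForm r m i' := by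
        simp only [linForm, map_sum, map_mul, scaleUX, aeval_X, Sum.elim_inl, Sum.elim_inr,
          if_neg h]
      rw [e]
      exact Ideal.subset_span ⟨i', rfl⟩

/-- Rescaling by `c` and then by `c⁻¹` is the identity. [folklore] -/
theorem scaleU_scaleU_inv (r m : ℕ) (i : Fin r) {c : ℚ} (hc : c ≠ 0) (G : RU r m) :
    scaleU r m i c (scaleU r m i c⁻¹ G) = G := by
  have h : (scaleU r m i c).comp (scaleU r m i c⁻¹) = AlgHom.id ℚ (RU r m) := by
    apply MvPolynomial.algHom_ext
    intro v
    simp only [AlgHom.comp_apply, scaleU, aeval_X, AlgHom.id_apply]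
    split_ifs with hv
    · rw [map_mul, algHom_C, MvPolynomial.algebraMap_eq, aeval_X, if_pos hv, ← mul_assoc,
        ← C_mul, inv_mul_cancel₀ hc, C_1, one_mul]
    · rw [aeval_X, if_neg hv]
  exact AlgHom.congr_fun h G

/-- The degree of the exponent `γ` in the block of variables `uᵢ`. [folklore] -/
def bdeg {r m : ℕ} (i : Fin r) (γ : Fin r × Fin (m + 1) →₀ ℕ) : ℕ :=
  ∑ j : Fin (m + 1), γ (i, j)

/-- `scaleU` acts diagonally on monomials: `U^γ ↦ c^{deg_{uᵢ} γ} U^γ`. [folklore] -/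
theorem scaleU_monomial (r m : ℕ) (i : Fin r) (c : ℚ) (γ : Fin r × Fin (m + 1) →₀ ℕ) (a : ℚ) :
    scaleU r m i c (monomial γ a) = monomial γ (c ^ bdeg i γ * a) := by
  have hprod : (γ.prod fun v e => (if v.1 = i then C c * X v else X v : RU r m) ^ e) =
      C (c ^ bdeg i γ) * γ.prod fun v e => (X v : RU r m) ^ e := by
    have h1 : ∀ (v : Fin r × Fin (m + 1)) (e : ℕ),
        (if v.1 = i then C c * X v else X v : RU r m) ^ e =
          C ((if v.1 = i then c else 1) ^ e) * X v ^ e := by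
      intro v e
      split_ifs <;> simp [mul_pow]
    simp_rw [h1]
    rw [Finsupp.prod_mul]
    congr 1
    rw [Finsupp.prod_fintype _ _ (fun v => by simp), ← map_prod C]
    congr 1
    rw [Fintype.prod_prod_type, Finset.prod_eq_single i (fun i' _ hi' => by simp [hi'])
      (fun h => absurd (Finset.mem_univ i) h)]
    simp [bdeg, Finset.prod_pow_eq_pow_sum]
  simp only [scaleU, aeval_monomial, MvPolynomial.algebraMap_eq]
  rw [hprod, ← mul_assoc, ← C_mul, mul_comm a, monomial_eq]

/-- Coefficientwise: `coeff γ (scaleU F) = c^{deg_{uᵢ} γ} · coeff γ F`. [folklore] -/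
theorem coeff_scaleU (r m : ℕ) (i : Fin r) (c : ℚ) (F : RU r m) (γ : Fin r × Fin (m + 1) →₀ ℕ) :
    coeff γ (scaleU r m i c F) = c ^ bdeg i γ * coeff γ F := by
  classical
  conv_lhs => rw [F.as_sum, map_sum]
  simp only [scaleU_monomial, coeff_sum, coeff_monomial]
  rw [Finset.sum_ite_eq']
  split_ifs with h
  · rfl
  · rw [MvPolynomial.notMem_support_iff.mp h, mul_zero]

/-- All monomials of the associated form have the same degree in each block `uᵢ`
(multihomogeneity). [cite: NesterenkoPhilippon2001, Ch. 3, remark after Prop. 4.4 (p. 38)] -/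
theorem bdeg_eq_bdeg_of_mem_support_chowForm (I : Ideal (Rx m)) (r : ℕ) (i : Fin r)
    {γ γ' : Fin r × Fin (m + 1) →₀ ℕ} (hγ : γ ∈ (chowForm I r).support)
    (hγ' : γ' ∈ (chowForm I r).support) : bdeg i γ = bdeg i γ' := by
  by_cases hpr : (elimIdeal I r).IsPrincipal
  swap
  · simp [chowForm, hpr] at hγ
  obtain ⟨c, -, hcF⟩ := exists_eq_C_mul_chowForm I r (scaleU r m i 2) (scaleU r m i 2⁻¹)
    (fun G hG => scaleU_mem_elimIdeal I r i 2 hG) (fun G hG => scaleU_mem_elimIdeal I r i 2⁻¹ hG)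
    (scaleU_scaleU_inv r m i two_ne_zero) hpr
  have key : ∀ δ ∈ (chowForm I r).support, (2 : ℚ) ^ bdeg i δ = c := by
    intro δ hδ
    have h := congrArg (coeff δ) hcF
    rw [coeff_scaleU, coeff_C_mul] at h
    exact mul_right_cancel₀ (mem_support_iff.mp hδ) h
  have h2 := (key γ hγ).trans (key γ' hγ').symm
  exact pow_right_injective₀ (by norm_num) (by norm_num) h2

/-! ### Permuting the blocks of variables -/

/-- The automorphism `u_{ij} ↦ u_{σ(i) j}` of `ℚ[U]`. [folklore] -/
def swapU (r m : ℕ) (σ : Equiv.Perm (Fin r)) : RU r m →ₐ[ℚ] RU r m :=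
  rename (Prod.map σ id)

/-- Its extension to `ℚ[U, x̲]` fixing the `xⱼ`. [folklore] -/
def swapUX (r m : ℕ) (σ : Equiv.Perm (Fin r)) : RUX r m →ₐ[ℚ] RUX r m :=
  rename (Sum.map (Prod.map σ id) id)

/-- `Ī(r)` is stable under permuting the blocks (it permutes the `Lᵢ`). [folklore] -/
theorem swapU_mem_elimIdeal (I : Ideal (Rx m)) (r : ℕ) (σ : Equiv.Perm (Fin r)) {G : RU r m}
    (hG : G ∈ elimIdeal I r) : swapU r m σ G ∈ elimIdeal I r := by
  refine map_mem_elimIdeal I r (swapU r m σ) (swapUX r m σ) (fun v => ?_) (fun j => ?_)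
    (fun i' => ?_) hG
  · simp [swapU, swapUX]
  · simp [swapUX]
  · have e : swapUX r m σ (linForm r m i') = linForm r m (σ i') := by
      simp [swapUX, linForm, map_sum]
    rw [e]
    exact Ideal.subset_span ⟨σ i', rfl⟩

/-- `swapU σ ∘ swapU σ⁻¹ = id`. [folklore] -/
theorem swapU_swapU_symm (r m : ℕ) (σ : Equiv.Perm (Fin r)) (G : RU r m) :
    swapU r m σ (swapU r m σ.symm G) = G := by
  rw [swapU, swapU, rename_rename]
  have : (Prod.map σ id ∘ Prod.map σ.symm id : Fin r × Fin (m + 1) → Fin r × Fin (m + 1)) = id := by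
    funext ⟨a, b⟩
    simp
  rw [this, rename_id]
  rfl

/-- The support of the associated form is stable under permuting the blocks (symmetry of `F` in
`u₁, …, u_r`). [cite: NesterenkoPhilippon2001, Ch. 3, remark after Prop. 4.4 (p. 38)] -/
theorem mapDomain_mem_support_chowForm (I : Ideal (Rx m)) (r : ℕ) (σ : Equiv.Perm (Fin r))
    {γ : Fin r × Fin (m + 1) →₀ ℕ} (hγ : γ ∈ (chowForm I r).support) :
    Finsupp.mapDomain (Prod.map σ id) γ ∈ (chowForm I r).support := by
  by_cases hpr : (elimIdeal I r).IsPrincipal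
  swap
  · simp [chowForm, hpr] at hγ
  obtain ⟨c, -, hcF⟩ := exists_eq_C_mul_chowForm I r (swapU r m σ) (swapU r m σ.symm)
    (fun G hG => swapU_mem_elimIdeal I r σ hG) (fun G hG => swapU_mem_elimIdeal I r σ.symm hG)
    (swapU_swapU_symm r m σ) hpr
  have hinj : Function.Injective (Prod.map σ id : Fin r × Fin (m + 1) → Fin r × Fin (m + 1)) :=
    (σ.prodCongr (Equiv.refl _)).injective
  have h := coeff_rename_mapDomain (Prod.map σ id) hinj (chowForm I r) γ
  change coeff (Finsupp.mapDomain (Prod.map σ id) γ) (swapU r m σ (chowForm I r)) =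
    coeff γ (chowForm I r) at h
  rw [hcF, coeff_C_mul] at h
  rw [mem_support_iff] at hγ ⊢
  intro h0
  rw [h0, mul_zero] at h
  exact hγ h.symm

/-- All block degrees of all monomials of the associated form equal `deg I = deg_{u₁} F`.
[cite: NesterenkoPhilippon2001, Ch. 3, remark after Prop. 4.4 and Def. 4.5 (p. 38)] -/
theorem bdeg_eq_ideg_of_mem_support_chowForm (I : Ideal (Rx m)) {r : ℕ} (hr : 0 < r)
    {γ : Fin r × Fin (m + 1) →₀ ℕ} (hγ : γ ∈ (chowForm I r).support) (i : Fin r) :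
    bdeg i γ = ideg I r := by
  set i₀ : Fin r := ⟨0, hr⟩
  have hideg : ideg I r = bdeg i₀ γ := by
    rw [ideg, dif_pos hr]
    change (chowForm I r).support.sup (bdeg i₀) = bdeg i₀ γ
    apply le_antisymm
    · exact Finset.sup_le fun δ hδ => (bdeg_eq_bdeg_of_mem_support_chowForm I r i₀ hδ hγ).le
    · exact Finset.le_sup (f := bdeg i₀) hγ
  set σ : Equiv.Perm (Fin r) := Equiv.swap i₀ i
  have hγ₁ := mapDomain_mem_support_chowForm I r σ hγ
  have hinj : Function.Injective (Prod.map σ id : Fin r × Fin (m + 1) → Fin r × Fin (m + 1)) :=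
    (σ.prodCongr (Equiv.refl _)).injective
  have hcomp : bdeg i₀ (Finsupp.mapDomain (Prod.map σ id) γ) = bdeg i γ := by
    unfold bdeg
    refine Finset.sum_congr rfl fun j _ => ?_
    have e : ((i₀, j) : Fin r × Fin (m + 1)) = Prod.map σ id (i, j) := by
      simp [σ, Equiv.swap_apply_right]
    rw [e, Finsupp.mapDomain_apply hinj]
  rw [← hcomp, bdeg_eq_bdeg_of_mem_support_chowForm I r i₀ hγ₁ hγ, ← hideg]

/-- Every monomial of the associated form `F` of index `r ≥ 1` has total degree `r · deg I`
(so `ϰ(F)` is homogeneous of degree `r deg I` in `ω̄`, which is what makes `|I(ω̄)|`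
well-scaled). [cite: NesterenkoPhilippon2001, Ch. 3, remark after Prop. 4.4 and Def. 4.6 (p. 38–39)] -/
theorem degree_eq_of_mem_support_chowForm (I : Ideal (Rx m)) {r : ℕ} (hr : 0 < r)
    {γ : Fin r × Fin (m + 1) →₀ ℕ} (hγ : γ ∈ (chowForm I r).support) :
    γ.degree = r * ideg I r := by
  rw [Finsupp.degree_eq_sum, Fintype.sum_prod_type]
  have h : ∀ i : Fin r, ∑ j : Fin (m + 1), γ (i, j) = ideg I r := fun i =>
    bdeg_eq_ideg_of_mem_support_chowForm I hr hγ i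
  simp only [h, Finset.sum_const, Finset.card_univ, Fintype.card_fin, smul_eq_mul]

/-! ### `ϰ_β̄(F) = 0` for `β̄ ∈ V(I)` -/

/-- A quadratic form with skew-symmetric coefficient matrix vanishes:
`ᵗ(c b̄) S⁽ⁱ⁾ b̄ = ∑_{j,k} s⁽ⁱ⁾_{jk} (c b_k) b_j = 0`. [folklore] -/
theorem sum_sum_skewEntry_mul_eq_zero {r : ℕ} (i : Fin r) (b : Fin (m + 1) → ℂ) (a : ℂ) :
    ∑ j : Fin (m + 1), (∑ k : Fin (m + 1), skewEntry i j k * C ((a • b) k)) * C (b j) =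
      (0 : RS r m) := by
  have expand : ∑ j : Fin (m + 1), (∑ k : Fin (m + 1), skewEntry i j k * C ((a • b) k)) * C (b j) =
      ∑ j : Fin (m + 1), ∑ k : Fin (m + 1), skewEntry i j k * C (a * b k * b j) := by
    refine Finset.sum_congr rfl fun j _ => ?_
    rw [Finset.sum_mul]
    refine Finset.sum_congr rfl fun k _ => ?_
    rw [Pi.smul_apply, smul_eq_mul, mul_assoc, ← map_mul]
  rw [expand]
  set S : Fin (m + 1) → Fin (m + 1) → RS r m := fun j k => skewEntry i j k * C (a * b k * b j)
  have hS : ∀ j k, S k j = -S j k := fun j k => by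
    simp only [S, map_mul]
    rw [skewEntry_swap i j k]
    ring
  have hT : ∑ j, ∑ k, S j k = -∑ j, ∑ k, S j k := by
    calc ∑ j, ∑ k, S j k = ∑ k, ∑ j, S j k := Finset.sum_comm
      _ = ∑ k, ∑ j, -S k j := by simp_rw [← hS]
      _ = -∑ j, ∑ k, S j k := by simp [Finset.sum_neg_distrib]
  exact add_self_eq_zero.mp (eq_neg_iff_add_eq_zero.mp hT)

/-- **`ϰ_{cβ̄}(F) = 0` for every zero `β̄` of `I`.** Substituting `x̲ = β̄` and `uᵢ = S⁽ⁱ⁾(cβ̄)` in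
`F xⱼ^M ∈ (I, L₁, …, L_r)` kills the right-hand side (`P(β̄) = 0` for `P ∈ I`, and
`Lᵢ ↦ ᵗ(cβ̄) S⁽ⁱ⁾ β̄ = 0` by skew-symmetry), whence `ϰ_{cβ̄}(F) βⱼ^M = 0` in the domain `ℂ[s]`.
[cite: NesterenkoPhilippon2001, Ch. 3 Def. 4.3, Def. 4.6 (p. 38–39)] -/
theorem kappa_smul_chowForm_eq_zero (I : Ideal (Rx m)) (r : ℕ) {β : Fin (m + 1) → ℂ}
    (hβ : β ∈ projZeros I) (c : ℂ) : kappa (c • β) (chowForm I r) = 0 := by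
  by_cases hpr : (elimIdeal I r).IsPrincipal
  swap
  · rw [chowForm, dif_neg hpr]
    exact map_zero _
  have hF : chowForm I r ∈ elimIdeal I r := by
    rw [← span_chowForm I r hpr]
    exact Ideal.mem_span_singleton_self _
  obtain ⟨M, -, hM⟩ := hF
  obtain ⟨hβ0, hβI⟩ := hβ
  obtain ⟨j, hj⟩ := Function.ne_iff.mp hβ0
  have hC : ∀ P : Rx m, aeval (fun j => C (β j) : Fin (m + 1) → RS r m) P = C (aeval β P) := by
    intro P
    induction P using MvPolynomial.induction_on with
    | C a => simp [MvPolynomial.algebraMap_apply]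
    | add p q hp hq => simp [hp, hq]
    | mul_X p k hp => simp [hp]
  obtain ⟨ev, ev_inl, ev_X, ev_inr, ev_L⟩ : ∃ ev : RUX r m →ₐ[ℚ] RS r m,
      (∀ G : RU r m, ev (rename Sum.inl G) = kappa (c • β) G) ∧
      (∀ j, ev (X (Sum.inr j)) = C (β j)) ∧
      (∀ P : Rx m, ev (rename Sum.inr P) = C (aeval β P)) ∧
      (∀ i, ev (linForm r m i) = 0) := by
    refine ⟨aeval (Sum.elim (fun v => ∑ k : Fin (m + 1), skewEntry v.1 v.2 k * C ((c • β) k))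
      fun j => C (β j)), fun G => ?_, fun j => ?_, fun P => ?_, fun i => ?_⟩
    · simp only [kappa, aeval_rename, Function.comp_def, Sum.elim_inl]
    · rw [aeval_X, Sum.elim_inr]
    · rw [aeval_rename]
      exact hC P
    · have e : aeval (Sum.elim (fun v => ∑ k : Fin (m + 1), skewEntry v.1 v.2 k * C ((c • β) k))
          fun j => C (β j)) (linForm r m i) =
          ∑ j : Fin (m + 1), (∑ k : Fin (m + 1), skewEntry i j k * C ((c • β) k)) * C (β j) := by
        simp only [linForm, map_sum, map_mul, aeval_X, Sum.elim_inl, Sum.elim_inr]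
      rw [e]
      exact sum_sum_skewEntry_mul_eq_zero i β c
  have hker : extIdeal I r ≤ RingHom.ker ev := by
    refine sup_le ?_ ?_
    · rw [Ideal.map_le_iff_le_comap]
      intro P hP
      rw [Ideal.mem_comap, RingHom.mem_ker, ev_inr, hβI P hP, map_zero]
    · rw [Ideal.span_le]
      rintro _ ⟨i, rfl⟩
      exact ev_L i
  have h := hker (hM j)
  rw [RingHom.mem_ker, map_mul, map_pow, ev_inl, ev_X] at h
  exact (mul_eq_zero.mp h).resolve_right
    (pow_ne_zero _ ((C_eq_zero (σ := Fin r × SkewIdx m)).not.mpr hj))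

end Nesterenko

end Literature.NumberTheory.Transcendental

end
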